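import Mathlib
import HarnessLib
import Summits.NavierStokesRegularity.NavierStokesRegularity.Theorems.PoloidalWindowDoorLrcModEntireQ4TimeWebFunction

/-!
# Route `PoloidalWindowDoor`, item `LrcModEntire` (stmt-NavierStokesRegularity-20428), cells (Q4-*) of the (TH) column over a STRAIGHT branch —
# THE SPACE–TIME WEB PACKAGE: web data, ridge law and THE HUYGENS IDENTITY AT EVERY NEARBY TIME, parallel webs at `τ = 0`

Cell ns-regularity-ideate, helper seat ns-k2-port-2 g8 under the LEAD of item 20428 (ns-poloidal-K2-p3 g17); `--supports stmt-NavierStokesRegularity-20428 --as helper`.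
Companion of the LEAD's `…Q4WebPackage.line_web_package` (slice `τ = 0`): with the jointly smooth web function of `…Q4TimeWebFunction.exists_timeWebFunction`,
the per-time inputs of the tree — horizontal criticality from the web Fermat law (`…RidgeWebLaw.webData_of_fderiv_uncurry`), the ridge law
(`…RidgeWebLawHoriz.horizLaplacian_two_eq_of_webFermat`), the slice law (`…TimeHeightShearLinearSlice.plane_wave_identity`) — hold at EVERY `|τ| < δ′`, so
LEAD g16's pin-free `…ParallelWebsIdentity.huygens_identity` gives:

* ★★ `time_web_package_line` — hypotheses = those of `line_web_package`; a window `δ′ ≤ δ, ρ`, `δ′ < 1/2`, the space–time web function `n₀(τ,s,z)` and a ridge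
  curvature `κ(τ,z)` with, for all `|τ|, |z| < δ′`, `s ∈ ℝ`: maximiser + value `R τ z` + uniqueness, horizontal criticality of `U₂(−1+τ,·)` at the web point,
  `n₀ ∈ C^m` jointly for every `m : ℕ∞`, `κ(τ,z) > 0` and the ridge law `D²(F τ)(W)[e,e] + D²(F τ)(W)[Je,Je] = −κ(τ,z)` (`F τ = σU₂(−1+τ,·)`), **the Huygens identity
  `κ(τ,z)·(∂_z n₀)² = (∂_z²R(τ,·)(z) − μ(−1+τ,z)κ(τ,z))·(1 + (∂_s n₀)²)`** in `fderiv ℝ n₀ q (0,0,1)` / `(0,1,0)` currency (the hypothesis shape of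
  `…Q4SonicHotSheetTimeSplit.webSpeed_split`), and the parallel webs at `τ = 0` (`n₀(0,s,z) = n₀(0,0,z)`, `…ParallelWebs.parallelWebs`).

WHAT THIS IS NOT: not a claim about Navier–Stokes regularity — structure of the hypothetical web of the research cells (Q4-*) (registry twist_split v11); no stub is
closed here; items 20428 / 19708 / 27893 OPEN.
-/

noncomputable section

set_option linter.dupNamespace false
set_option linter.style.longLine false

namespace Summit.NavierStokesRegularity.NavierStokesRegularity.Theorems.PoloidalWindowDoorLrcModEntireQ4TimeWebPackage

open Set Function Filter Topology Metric
open scoped RealInnerProductSpace InnerProductSpace Laplacian ContDiff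
open Literature.Analysis Literature.Analysis.FluidPDE Literature.Analysis.UnboundedOperators
open Summit.NavierStokesRegularity.NavierStokesRegularity.Theorems
open Summit.NavierStokesRegularity.NavierStokesRegularity.Theorems.PoloidalWindowDoorLrcModEntireSheetFlattenTools
open Summit.NavierStokesRegularity.NavierStokesRegularity.Theorems.PoloidalWindowDoorLrcModEntireParallelWebsIdentity
open Summit.NavierStokesRegularity.NavierStokesRegularity.Theorems.PoloidalWindowDoorLrcModEntireParallelWebs
open Summit.NavierStokesRegularity.NavierStokesRegularity.Theorems.PoloidalWindowDoorLrcModEntireQ4LineTools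
open Summit.NavierStokesRegularity.NavierStokesRegularity.Theorems.PoloidalWindowDoorLrcModEntireQ4LineWeb
open Summit.NavierStokesRegularity.NavierStokesRegularity.Theorems.PoloidalWindowDoorLrcModEntireRidgeWebLaw
open Summit.NavierStokesRegularity.NavierStokesRegularity.Theorems.PoloidalWindowDoorLrcModEntireRidgeClassConstants
open Summit.NavierStokesRegularity.NavierStokesRegularity.Theorems.PoloidalWindowDoorLrcModEntireRidgeWebLawHoriz
open Summit.NavierStokesRegularity.NavierStokesRegularity.Theorems.PoloidalWindowDoorLrcModEntireTwistingTHSlopeSign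

open Summit.NavierStokesRegularity.NavierStokesRegularity.Theorems.PoloidalWindowDoorLrcModEntireQ4TimeWebFunction

variable {C : ℝ} {U : ℝ → EuclideanSpace ℝ (Fin 3) → EuclideanSpace ℝ (Fin 3)} {Γ νΓ : ℝ → EuclideanSpace ℝ (Fin 3)} {R μ : ℝ → ℝ → ℝ}
  {σ κ r δ ρ : ℝ}

/-- ★★ **THE SPACE–TIME WEB PACKAGE OF A STRAIGHT HOT BRANCH** (hypotheses = those of `…Q4WebPackage.line_web_package`): a window `δ′`, a space–time web
function `n₀(τ,s,z)` and a ridge curvature `κ(τ,z) > 0` with, for ALL `|τ| < δ′`, `|z| < δ′`, `s`: maximiser + value `R τ z` + uniqueness, horizontal criticality,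
`n₀ ∈ C^m` (every `m`), the ridge law, the HUYGENS IDENTITY `κ·(∂_z n₀)² = (R_zz − μκ)·(1 + (∂_s n₀)²)` (`fderiv ℝ n₀` currency), and parallel webs at `τ = 0`. -/
theorem time_web_package_line
    (hUrate : HasTypeITimeDecay C U) (hUcont : ContinuousOn (uncurry U) (Iio (0 : ℝ) ×ˢ univ))
    (hUmild : ∀ s t : ℝ, s < t → t < 0 → ∀ x, U t x = heatExtension (U s) (t - s) x - oseenDuhamel 1 s U U t x)
    (hUdiv : ∀ t < 0, VectorCalculus.IsDivFree (U t))
    (hUpol : ∀ s < 0, ∀ q, ⟪curl (U s) q, EuclideanSpace.single 2 1⟫_ℝ = 0)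
    (hUne : U (-1) 0 2 ≠ 0) (hUhotbd : ∀ t < 0, ∀ x, Real.sqrt (-t) * |U t x 2| ≤ |U (-1) 0 2|)
    (hσ : σ = 1 ∨ σ = -1) (hσN : σ * U (-1) 0 2 = |U (-1) 0 2|) (hκ : 0 < κ)
    (hΓ0 : Γ 0 = 0) (hΓ2 : ∀ s, Γ s 2 = 0) (hΓunit : ∀ s, ‖deriv Γ s‖ = 1) (hΓhot : ∀ s, U (-1) (Γ s) 2 = U (-1) 0 2)
    (hν : ∀ s, νΓ s = WithLp.toLp 2 ![-(deriv Γ s 1), deriv Γ s 0, 0])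
    (hΓcurv : ∀ s, κ ≤ -(fderiv ℝ (fderiv ℝ (fun y => σ * U (-1) y 2)) (Γ s) (νΓ s) (νΓ s)))
    (hr : 0 < r) (hδ : 0 < δ)
    (hconc : ∀ τ z : ℝ, |τ| < δ → |z| < δ → ∀ s : ℝ, ∀ n ∈ Ioo (-r) r,
      fderiv ℝ (fderiv ℝ (fun y => σ * U (-1 + τ) y 2)) (Γ s + n • νΓ s + z • EuclideanSpace.single 2 (1 : ℝ)) (νΓ s) (νΓ s) < 0)
    (hweb : ∀ τ₀ z₀ : ℝ, |τ₀| < δ → |z₀| < δ → ∀ s₀ : ℝ, ∃ n₀ ∈ Ioo (-r) r,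
      σ * U (-1 + τ₀) (Γ s₀ + n₀ • νΓ s₀ + z₀ • EuclideanSpace.single 2 (1 : ℝ)) 2 = R τ₀ z₀ ∧
      (∀ n ∈ Icc (-r) r, n ≠ n₀ → σ * U (-1 + τ₀) (Γ s₀ + n • νΓ s₀ + z₀ • EuclideanSpace.single 2 (1 : ℝ)) 2 < R τ₀ z₀) ∧
      DifferentiableAt ℝ (uncurry R) (τ₀, z₀) ∧
      fderiv ℝ (uncurry fun τ y => σ * U (-1 + τ) y 2) (τ₀, Γ s₀ + n₀ • νΓ s₀ + z₀ • EuclideanSpace.single 2 (1 : ℝ)) =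
        (fderiv ℝ (uncurry R) (τ₀, z₀)).comp
          ((ContinuousLinearMap.fst ℝ ℝ (EuclideanSpace ℝ (Fin 3))).prod
            ((EuclideanSpace.proj (2 : Fin 3)).comp (ContinuousLinearMap.snd ℝ ℝ (EuclideanSpace ℝ (Fin 3))))))
    (hρ : 0 < ρ) (hμ3 : ContDiff ℝ 3 (uncurry μ))
    (hslabU : ∀ t : ℝ, |t + 1| < ρ → ∀ x : EuclideanSpace ℝ (Fin 3), |x 2| < ρ → ∀ b : Fin 3, b ≠ 2 →
      fderiv ℝ (U t) x (EuclideanSpace.single 2 1) b = μ t (x 2) * fderiv ℝ (U t) x (EuclideanSpace.single b 1) 2)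
    (hevU : ∀ t₀ : ℝ, |t₀ + 1| < ρ → ∀ y₀ : EuclideanSpace ℝ (Fin 3), y₀ 2 = 0 →
      ∀ᶠ z in 𝓝 ((t₀, y₀) : ℝ × EuclideanSpace ℝ (Fin 3)), ∀ b : Fin 3, b ≠ 2 →
        fderiv ℝ (U z.1) z.2 (EuclideanSpace.single 2 1) b = μ z.1 (z.2 2) * fderiv ℝ (U z.1) z.2 (EuclideanSpace.single b 1) 2)
    (hline : ∀ s : ℝ, Γ s = s • deriv Γ 0) :
    ∃ (δ' : ℝ) (n₀ : ℝ × ℝ × ℝ → ℝ) (κt : ℝ → ℝ → ℝ), 0 < δ' ∧ δ' ≤ δ ∧ δ' ≤ ρ ∧ δ' < 1 / 2 ∧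
      deriv Γ 0 2 = 0 ∧ deriv Γ 0 0 ^ 2 + deriv Γ 0 1 ^ 2 = 1 ∧
      (∀ q : ℝ × ℝ × ℝ, |q.1| < δ' → |q.2.2| < δ' →
        n₀ q ∈ Ioo (-r) r ∧
        σ * U (-1 + q.1) (frameCLM (deriv Γ 0) (q.2.1, n₀ q, q.2.2)) 2 = R q.1 q.2.2 ∧
        (∀ n ∈ Icc (-r) r, n ≠ n₀ q → σ * U (-1 + q.1) (frameCLM (deriv Γ 0) (q.2.1, n, q.2.2)) 2 < R q.1 q.2.2) ∧
        (∀ w : EuclideanSpace ℝ (Fin 3), w 2 = 0 → fderiv ℝ (fun y => U (-1 + q.1) y 2) (frameCLM (deriv Γ 0) (q.2.1, n₀ q, q.2.2)) w = 0) ∧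
        (∀ m : ℕ∞, ContDiffAt ℝ m n₀ q) ∧
        0 < κt q.1 q.2.2 ∧
        fderiv ℝ (fderiv ℝ (fun y => σ * U (-1 + q.1) y 2)) (frameCLM (deriv Γ 0) (q.2.1, n₀ q, q.2.2)) (deriv Γ 0) (deriv Γ 0) +
            fderiv ℝ (fderiv ℝ (fun y => σ * U (-1 + q.1) y 2)) (frameCLM (deriv Γ 0) (q.2.1, n₀ q, q.2.2)) (Jvec (deriv Γ 0)) (Jvec (deriv Γ 0)) =
          -κt q.1 q.2.2 ∧
        κt q.1 q.2.2 * (fderiv ℝ n₀ q ((0 : ℝ), (0 : ℝ), (1 : ℝ))) ^ 2 =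
          (deriv (deriv (R q.1)) q.2.2 - μ (-1 + q.1) q.2.2 * κt q.1 q.2.2) * (1 + (fderiv ℝ n₀ q ((0 : ℝ), (1 : ℝ), (0 : ℝ))) ^ 2)) ∧
      (∀ s z : ℝ, |z| < δ' → n₀ ((0 : ℝ), s, z) = n₀ ((0 : ℝ), (0 : ℝ), z)) := by
  have hm1 : (-1 : ℝ) < 0 := by norm_num
  obtain ⟨hΓd, he2, hunit, hνe, hpt⟩ := line_frame hline hΓ2 hΓunit hν
  set e : EuclideanSpace ℝ (Fin 3) := deriv Γ 0 with he_def
  set T : Set ℝ := Ioo (-1 / 2 : ℝ) (1 / 2) with hT_def; have hTo : IsOpen T := isOpen_Ioo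
  obtain ⟨F, hF_def⟩ : ∃ F : ℝ → EuclideanSpace ℝ (Fin 3) → ℝ, F = fun τ y => σ * U (-1 + τ) y 2 := ⟨_, rfl⟩
  have hFst : IsSmoothSpaceTimeOn T F := by
    have h := contDiffOn_uncurry_signed hUrate hUcont hUmild hUdiv σ (n := ⊤) (T := T) Subset.rfl
    rw [hF_def]; exact h
  have hTabs : ∀ τ : ℝ, |τ| < 1 / 2 → τ ∈ T := fun τ hτ => ⟨by linarith [(abs_lt.1 hτ).1], (abs_lt.1 hτ).2⟩
  set δ₀ : ℝ := min (min δ ρ) (1 / 4) with hδ₀_def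
  have hδ₀ : 0 < δ₀ := lt_min (lt_min hδ hρ) (by norm_num); have hδ₀h : δ₀ < 1 / 2 := lt_of_le_of_lt (min_le_right _ _) (by norm_num)
  have hδ₀δ : δ₀ ≤ δ := (min_le_left _ _).trans (min_le_left _ _); have hδ₀ρ : δ₀ ≤ ρ := (min_le_left _ _).trans (min_le_right _ _)
  have hδ₀T : Ioo (-δ₀) δ₀ ⊆ T := fun τ hτ => ⟨by linarith [hτ.1], by linarith [hτ.2]⟩
  have hconcF : ∀ τ z : ℝ, |τ| < δ₀ → |z| < δ₀ → ∀ s : ℝ, ∀ n ∈ Ioo (-r) r,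
      fderiv ℝ (fderiv ℝ (F τ)) (frameCLM e (s, n, z)) (Jvec e) (Jvec e) < 0 := by
    intro τ z hτ hz s n hn
    have h := hconc τ z (lt_of_lt_of_le hτ hδ₀δ) (lt_of_lt_of_le hz hδ₀δ) s n hn
    rw [hpt, hνe] at h
    rw [hF_def]; exact h
  have hS : ∀ τ z : ℝ, |τ| < δ₀ → |z| < δ₀ → ∀ s : ℝ, ∃ n₁ ∈ Ioo (-r) r, F τ (frameCLM e (s, n₁, z)) = R τ z ∧
      ∀ n ∈ Icc (-r) r, n ≠ n₁ → F τ (frameCLM e (s, n, z)) < R τ z := by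
    intro τ z hτ hz s
    obtain ⟨n₁, hn₁, hval, huniq, -, -⟩ := hweb τ z (lt_of_lt_of_le hτ hδ₀δ) (lt_of_lt_of_le hz hδ₀δ) s
    refine ⟨n₁, hn₁, ?_, fun n hn hne => ?_⟩
    · rw [hF_def, ← hpt]; exact hval
    · rw [hF_def, ← hpt]; exact huniq n hn hne
  obtain ⟨n₀, hspec, hcritν, hCm⟩ := exists_timeWebFunction (e := e) hTo hFst hδ₀T hconcF hS
  have hAweb : ∀ q : ℝ × ℝ × ℝ, |q.1| < δ₀ → |q.2.2| < δ₀ →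
      fderiv ℝ (uncurry fun τ y => σ * U (-1 + τ) y 2) (q.1, frameCLM e (q.2.1, n₀ q, q.2.2)) =
        (fderiv ℝ (uncurry R) (q.1, q.2.2)).comp ((ContinuousLinearMap.fst ℝ ℝ (EuclideanSpace ℝ (Fin 3))).prod
          ((EuclideanSpace.proj (2 : Fin 3)).comp (ContinuousLinearMap.snd ℝ ℝ (EuclideanSpace ℝ (Fin 3))))) := by
    intro q h1 h2
    obtain ⟨n₁, hn₁, hval₁, -, -, hfd⟩ := hweb q.1 q.2.2 (lt_of_lt_of_le h1 hδ₀δ) (lt_of_lt_of_le h2 hδ₀δ) q.2.1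
    have hn : n₁ = n₀ q := by
      by_contra hne
      have hlt := (hspec q h1 h2).2.2 n₁ (Ioo_subset_Icc_self hn₁) hne
      rw [hpt] at hval₁
      rw [hF_def] at hlt
      exact absurd hval₁ hlt.ne
    rw [hpt, hn] at hfd
    exact hfd
  have hhoriz : ∀ q : ℝ × ℝ × ℝ, |q.1| < δ₀ → |q.2.2| < δ₀ → ∀ w : EuclideanSpace ℝ (Fin 3), w 2 = 0 →
      fderiv ℝ (fun y => U (-1 + q.1) y 2) (frameCLM e (q.2.1, n₀ q, q.2.2)) w = 0 := by
    intro q h1 h2 w hw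
    have hτ : |q.1| < 1 / 2 := lt_trans h1 hδ₀h
    have h := webData_of_fderiv_uncurry hUrate hUcont hUmild hUdiv hσ hτ (hAweb q h1 h2) (hAweb q h1 h2) rfl
    have ht : -1 + q.1 < 0 := by linarith [(abs_lt.1 hτ).2]
    have hU1 : ContDiff ℝ 1 (U (-1 + q.1)) := contDiff_slice_of_class hUrate hUcont hUmild hUdiv ht
    have hUd : Differentiable ℝ (U (-1 + q.1)) := hU1.differentiable one_ne_zero
    exact fderiv_two_horizontal_eq_zero (hUd _) h.2.2.2.1 h.2.2.2.2.1 hw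
  -- slice regularity at every nearby time, frame identity and slice law (`…Q4TimeWebFunction`)
  have hFτ_def : ∀ τ, F τ = fun y => σ * U (-1 + τ) y 2 := fun τ => by rw [hF_def]
  have hθ2τ : ∀ τ : ℝ, |τ| < 1 / 2 → ContDiff ℝ 2 (fun y => U (-1 + τ) y 2) := fun τ hτ => contDiff_two_vert_at hUrate hUcont hUmild hUdiv hτ
  have hF3τ : ∀ τ : ℝ, |τ| < 1 / 2 → ContDiff ℝ 3 (F τ) := fun τ hτ =>
    (hFst.contDiff_slice (hTabs τ hτ)).of_le (by exact WithTop.coe_le_coe.2 le_top)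
  have hF2τ : ∀ τ : ℝ, |τ| < 1 / 2 → ContDiff ℝ 2 (F τ) := fun τ hτ =>
    (hFst.contDiff_slice (hTabs τ hτ)).of_le (by exact WithTop.coe_le_coe.2 le_top)
  have hframe : ∀ τ : ℝ, |τ| < 1 / 2 → ∀ x : EuclideanSpace ℝ (Fin 3),
      fderiv ℝ (fderiv ℝ (F τ)) x e e + fderiv ℝ (fderiv ℝ (F τ)) x (Jvec e) (Jvec e) =
        σ * (fderiv ℝ (fun w => fderiv ℝ (fun y => U (-1 + τ) y 2) w (EuclideanSpace.single 0 (1 : ℝ))) x (EuclideanSpace.single 0 (1 : ℝ)) +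
          fderiv ℝ (fun w => fderiv ℝ (fun y => U (-1 + τ) y 2) w (EuclideanSpace.single 1 (1 : ℝ))) x (EuclideanSpace.single 1 (1 : ℝ))) := by
    intro τ hτ x; rw [hFτ_def]; exact frame_trace_at hUrate hUcont hUmild hUdiv he2 hunit hτ x
  have hslice₀ : ∀ τ : ℝ, |τ| < 1 / 2 → |τ| < ρ → ∀ x : EuclideanSpace ℝ (Fin 3), |x 2| < ρ →
      fderiv ℝ (fderiv ℝ (F τ)) x e2 e2 =
        -μ (-1 + τ) (x 2) * (fderiv ℝ (fderiv ℝ (F τ)) x e e + fderiv ℝ (fderiv ℝ (F τ)) x (Jvec e) (Jvec e)) := by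
    intro τ hτ hτρ x hx; rw [hFτ_def]; exact slice_law_at hUrate hUcont hUmild hUdiv he2 hunit hτ hτρ hslabU hx
  have hW2 : ∀ s n z : ℝ, frameCLM e (s, n, z) 2 = z := fun s n z => frameCLM_apply_two he2 _
  obtain ⟨κt, hκt_def⟩ : ∃ κt : ℝ → ℝ → ℝ, κt = fun τ z => -(fderiv ℝ (fderiv ℝ (F τ)) (frameCLM e (0, n₀ (τ, 0, z), z)) e e +
      fderiv ℝ (fderiv ℝ (F τ)) (frameCLM e (0, n₀ (τ, 0, z), z)) (Jvec e) (Jvec e)) := ⟨_, rfl⟩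
  -- `n₀(0,s,0) = 0`: the hot branch is the base web (hot value + hot bound)
  have hFle : ∀ x, F 0 x ≤ σ * U (-1) 0 2 := by
    intro x
    rw [hFτ_def 0]; simp only [add_zero]
    have h1 : σ * U (-1) x 2 ≤ |U (-1) x 2| := by
      rcases hσ with h | h
      · rw [h, one_mul]; exact le_abs_self _
      · rw [h, neg_one_mul]; exact neg_le_abs _
    have h2 := hUhotbd (-1) hm1 x
    rw [neg_neg, Real.sqrt_one, one_mul] at h2
    rw [hσN]; exact h1.trans h2
  have hFΓ : ∀ s, F 0 (frameCLM e (s, 0, 0)) = σ * U (-1) 0 2 := by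
    intro s
    rw [← hpt s 0 0, zero_smul, zero_smul, add_zero, add_zero, hFτ_def 0]
    simp only [add_zero]; rw [hΓhot s]
  have hn00 : ∀ s : ℝ, n₀ ((0 : ℝ), s, (0 : ℝ)) = 0 := by
    intro s
    obtain ⟨-, hval, huniq⟩ := hspec ((0 : ℝ), s, (0 : ℝ)) (by simpa using hδ₀) (by simpa using hδ₀)
    by_contra hne
    have hlt := huniq 0 ⟨by linarith [hr], by linarith [hr]⟩ (Ne.symm hne)
    simp only at hlt hval
    rw [hFΓ] at hlt
    linarith [hFle (frameCLM e (s, n₀ ((0 : ℝ), s, (0 : ℝ)), 0))]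
  have hκ00 : κ ≤ κt 0 0 := by
    have hee : fderiv ℝ (fderiv ℝ (F 0)) 0 e e = 0 := by
      refine fderiv_fderiv_eq_zero_of_const_on_line (hF2τ 0 (by norm_num)) e (c := σ * U (-1) 0 2) fun s => ?_
      rw [← hline s, hFτ_def 0]; simp only [add_zero]; rw [hΓhot s]
    have hνν := hΓcurv 0
    rw [hΓ0, hνe] at hνν
    have hpt0 : frameCLM e ((0 : ℝ), n₀ ((0 : ℝ), (0 : ℝ), (0 : ℝ)), (0 : ℝ)) = 0 := by
      rw [hn00 0]; simp [frameCLM_apply]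
    rw [hκt_def]; simp only; rw [hpt0, hee, zero_add, hFτ_def 0]
    simp only [add_zero]
    exact hνν
  -- joint continuity of `(τ,z) ↦ κ(τ,z)` at `(0,0)` (`…Q4TimeWebFunction.continuousAt_sliceHessian`)
  have hn₀c : ContinuousAt (fun w : ℝ × ℝ => n₀ (w.1, 0, w.2)) ((0 : ℝ), (0 : ℝ)) := by
    have h1 : ContDiffAt ℝ 1 n₀ ((0 : ℝ), (0 : ℝ), (0 : ℝ)) := hCm 1 _ (by simpa using hδ₀) (by simpa using hδ₀)
    have h2 : ContinuousAt (fun w : ℝ × ℝ => ((w.1, (0 : ℝ), w.2) : ℝ × ℝ × ℝ)) ((0 : ℝ), (0 : ℝ)) :=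
      (continuous_fst.prodMk (continuous_const.prodMk continuous_snd)).continuousAt
    exact h1.continuousAt.comp_of_eq h2 rfl
  have hgc : ContinuousAt (fun w : ℝ × ℝ => frameCLM e (0, n₀ (w.1, 0, w.2), w.2)) ((0 : ℝ), (0 : ℝ)) :=
    (frameCLM e).continuous.continuousAt.comp (continuousAt_const.prodMk (hn₀c.prodMk continuousAt_snd))
  have hκc : ContinuousAt (fun w : ℝ × ℝ => κt w.1 w.2) ((0 : ℝ), (0 : ℝ)) := by
    have h := ((continuousAt_sliceHessian hTo hFst (w₀ := ((0 : ℝ), (0 : ℝ))) (hTabs 0 (by norm_num)) hgc e e).add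
      (continuousAt_sliceHessian hTo hFst (w₀ := ((0 : ℝ), (0 : ℝ))) (hTabs 0 (by norm_num)) hgc (Jvec e) (Jvec e))).neg
    rw [hκt_def]; exact h
  -- the slope function is `< 1` near `(−1, 0)`
  have hμc : ContinuousAt (fun w : ℝ × ℝ => μ (-1 + w.1) w.2) ((0 : ℝ), (0 : ℝ)) := by
    have h : ContinuousAt (fun w : ℝ × ℝ => ((-1 + w.1, w.2) : ℝ × ℝ)) ((0 : ℝ), (0 : ℝ)) :=
      ((continuous_const.add continuous_fst).prodMk continuous_snd).continuousAt
    exact hμ3.continuous.continuousAt.comp_of_eq h rfl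
  have hμle : μ (-1) 0 ≤ 0 :=
    slopeFunction_nonpos hUrate hUcont hUmild hUdiv hUpol hUne hUhotbd hμ3.continuous (hevU (-1) (by simp [hρ]) 0 rfl)
  obtain ⟨ε, hε, hball⟩ : ∃ ε > 0, ∀ w : ℝ × ℝ, |w.1| < ε → |w.2| < ε → 0 < κt w.1 w.2 ∧ μ (-1 + w.1) w.2 < 1 := by
    have h1 : ∀ᶠ w : ℝ × ℝ in 𝓝 ((0 : ℝ), (0 : ℝ)), 0 < κt w.1 w.2 := hκc.eventually_const_lt (lt_of_lt_of_le hκ hκ00)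
    have h2 : ∀ᶠ w : ℝ × ℝ in 𝓝 ((0 : ℝ), (0 : ℝ)), μ (-1 + w.1) w.2 < 1 :=
      hμc.eventually_lt_const (by simp only [add_zero]; linarith)
    obtain ⟨ε, hε, h⟩ := Metric.eventually_nhds_iff.1 (h1.and h2)
    refine ⟨ε, hε, fun w hw1 hw2 => h ?_⟩
    rw [Prod.dist_eq]; simp only [Real.dist_eq, sub_zero]; exact max_lt hw1 hw2
  set δ' : ℝ := min δ₀ ε with hδ'_def
  have hδ' : 0 < δ' := lt_min hδ₀ hε; have hδ'δ₀ : δ' ≤ δ₀ := min_le_left _ _; have hδ'ε : δ' ≤ ε := min_le_right _ _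
  have hI : ∀ q : ℝ × ℝ × ℝ, |q.1| < δ' → |q.2.2| < δ' →
      |q.1| < δ₀ ∧ |q.2.2| < δ₀ ∧ |q.1| < 1 / 2 ∧ |q.1| < ρ ∧ |q.2.2| < ρ ∧ 0 < κt q.1 q.2.2 ∧ μ (-1 + q.1) q.2.2 < 1 := by
    intro q h1 h2
    have h1' := lt_of_lt_of_le h1 hδ'δ₀
    have h2' := lt_of_lt_of_le h2 hδ'δ₀
    exact ⟨h1', h2', lt_trans h1' hδ₀h, lt_of_lt_of_le h1' hδ₀ρ, lt_of_lt_of_le h2' hδ₀ρ,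
      (hball (q.1, q.2.2) (lt_of_lt_of_le h1 hδ'ε) (lt_of_lt_of_le h2 hδ'ε)).1,
      (hball (q.1, q.2.2) (lt_of_lt_of_le h1 hδ'ε) (lt_of_lt_of_le h2 hδ'ε)).2⟩
  /- STEP 7: the ridge law at every nearby time. -/
  have hridge : ∀ q : ℝ × ℝ × ℝ, |q.1| < δ' → |q.2.2| < δ' →
      fderiv ℝ (fderiv ℝ (F q.1)) (frameCLM e (q.2.1, n₀ q, q.2.2)) e e +
        fderiv ℝ (fderiv ℝ (F q.1)) (frameCLM e (q.2.1, n₀ q, q.2.2)) (Jvec e) (Jvec e) = -κt q.1 q.2.2 := by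
    intro q h1 h2
    obtain ⟨h1₀, h2₀, hτh, hτρ, hzρ, -, hμ1⟩ := hI q h1 h2
    set y := frameCLM e (q.2.1, n₀ q, q.2.2) with hy
    set y' := frameCLM e (0, n₀ (q.1, 0, q.2.2), q.2.2) with hy'
    have hyy' : y 2 = y' 2 := by rw [hy, hy', hW2, hW2]
    have hO : IsOpen ({w : ℝ × EuclideanSpace ℝ (Fin 3) | |w.1 + 1| < ρ} ∩ {w | |w.2 2| < ρ}) :=
      (isOpen_lt (continuous_abs.comp (continuous_fst.add continuous_const)) continuous_const).inter
        (isOpen_lt (continuous_abs.comp ((EuclideanSpace.proj (𝕜 := ℝ) (2 : Fin 3)).continuous.comp continuous_snd)) continuous_const)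
    have hslopeEv : ∀ w : EuclideanSpace ℝ (Fin 3), w 2 = y 2 →
        ∀ᶠ v in 𝓝 ((-1 + q.1, w) : ℝ × EuclideanSpace ℝ (Fin 3)), ∀ b : Fin 3, b ≠ 2 →
          fderiv ℝ (U v.1) v.2 (EuclideanSpace.single 2 1) b = μ v.1 (v.2 2) * fderiv ℝ (U v.1) v.2 (EuclideanSpace.single b 1) 2 := by
      intro w hw
      have hmem : ((-1 + q.1 : ℝ), w) ∈ ({w : ℝ × EuclideanSpace ℝ (Fin 3) | |w.1 + 1| < ρ} ∩ {w | |w.2 2| < ρ}) := by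
        refine ⟨by simpa using hτρ, ?_⟩
        show |w 2| < ρ
        rw [hw, hy, hW2]; exact hzρ
      exact Filter.eventually_of_mem (hO.mem_nhds hmem) fun v hv => hslabU v.1 hv.1 v.2 hv.2
    have hplane' : ∀ w : EuclideanSpace ℝ (Fin 3), w 2 = y 2 → ∀ b : Fin 3, b ≠ 2 →
        fderiv ℝ (U (-1 + q.1)) w (EuclideanSpace.single 2 1) b = μ (-1 + q.1) (y 2) * fderiv ℝ (U (-1 + q.1)) w (EuclideanSpace.single b 1) 2 := by
      intro w hw b hb
      rw [hy, hW2]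
      have h := hslabU (-1 + q.1) (by simpa using hτρ) w (by rw [hw, hy, hW2]; exact hzρ) b hb
      rw [hw, hy, hW2] at h; exact h
    have hμ1' : μ (-1 + q.1) (y 2) ≠ 1 := by rw [hy, hW2]; exact hμ1.ne
    have hvalEq : σ * U (-1 + q.1) y 2 = σ * U (-1 + q.1) y' 2 := by
      have ha := (hspec q h1₀ h2₀).2.1
      have hb := (hspec (q.1, 0, q.2.2) h1₀ h2₀).2.1
      rw [hFτ_def] at ha hb
      simp only at ha hb
      rw [hy, hy', ha, hb]
    have hA := hAweb q h1₀ h2₀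
    have hA' := hAweb (q.1, 0, q.2.2) h1₀ h2₀
    have h := horizLaplacian_two_eq_of_webFermat hUrate hUcont hUmild hUdiv hUpol hμ3 hτh hyy' hslopeEv hplane' hμ1' hσ hA hA' hvalEq
    rw [hκt_def]; simp only
    rw [hframe q.1 hτh, hframe q.1 hτh, h, neg_neg]
  have hslice : ∀ q : ℝ × ℝ × ℝ, |q.1| < δ' → |q.2.2| < δ' → ∀ n : ℝ,
      fderiv ℝ (fderiv ℝ (F q.1)) (frameCLM e (q.2.1, n, q.2.2)) e2 e2 =
        -μ (-1 + q.1) q.2.2 * (fderiv ℝ (fderiv ℝ (F q.1)) (frameCLM e (q.2.1, n, q.2.2)) e e +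
          fderiv ℝ (fderiv ℝ (F q.1)) (frameCLM e (q.2.1, n, q.2.2)) (Jvec e) (Jvec e)) := by
    intro q h1 h2 n
    obtain ⟨-, -, hτh, hτρ, hzρ, -, -⟩ := hI q h1 h2
    have h := hslice₀ q.1 hτh hτρ (frameCLM e (q.2.1, n, q.2.2)) (by rw [hW2]; exact hzρ)
    rw [hW2] at h; exact h
  /- STEP 8: regularity of the slice web function and of `R τ` on the window. -/
  have hGτd : ∀ q : ℝ × ℝ × ℝ, |q.1| < δ' → |q.2.2| < δ' →
      HasFDerivAt (fun p : ℝ × ℝ => n₀ (q.1, p)) ((fderiv ℝ n₀ q).comp (ContinuousLinearMap.inr ℝ ℝ (ℝ × ℝ))) q.2 := by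
    intro q h1 h2
    obtain ⟨h1₀, h2₀, -⟩ := hI q h1 h2
    have hd : DifferentiableAt ℝ n₀ (q.1, q.2) := (hCm 1 q h1₀ h2₀).differentiableAt (by simp)
    exact hd.hasFDerivAt.comp q.2 (hasFDerivAt_sliceIncl q.1 q.2)
  have hRω : ∀ τ z : ℝ, |τ| < δ' → |z| < δ' → ContDiffAt ℝ 3 (R τ) z := by
    intro τ z hτ hz
    obtain ⟨hτ₀, hz₀, hτh, -⟩ := hI (τ, 0, z) hτ hz
    have hW : ContDiffAt ℝ 3 (fun z' : ℝ => frameCLM e (0, n₀ (τ, 0, z'), z')) z := by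
      have h1 : ContDiffAt ℝ 3 (fun z' : ℝ => n₀ (τ, 0, z')) z :=
        (hCm 3 (τ, 0, z) hτ₀ hz₀).comp z (contDiffAt_const.prodMk (contDiffAt_const.prodMk contDiffAt_id))
      exact (frameCLM e).contDiff.contDiffAt.comp z (contDiffAt_const.prodMk (h1.prodMk contDiffAt_id))
    refine (((hF3τ τ hτh).contDiffAt).comp z hW).congr_of_eventuallyEq ?_
    filter_upwards [(isOpen_lt continuous_abs continuous_const).mem_nhds (hz₀ : z ∈ {z' : ℝ | |z'| < δ₀})] with z' hz'
    rw [Function.comp_apply]; exact ((hspec (τ, 0, z') hτ₀ hz').2.1).symm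
  have habs : ∀ z : ℝ, z ∈ Ioo (-δ') δ' ↔ |z| < δ' := fun z => by rw [mem_Ioo, abs_lt]
  have hRon : ∀ τ : ℝ, |τ| < δ' → ContDiffOn ℝ 3 (R τ) (Ioo (-δ') δ') := fun τ hτ z hz => (hRω τ z hτ ((habs z).1 hz)).contDiffWithinAt
  have hR1on : ∀ τ : ℝ, |τ| < δ' → ContDiffOn ℝ 2 (deriv (R τ)) (Ioo (-δ') δ') := fun τ hτ =>
    ((contDiffOn_succ_iff_deriv_of_isOpen isOpen_Ioo).1 (hRon τ hτ)).2.2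
  have hRd : ∀ τ : ℝ, |τ| < δ' → ∀ z ∈ Ioo (-δ') δ', DifferentiableAt ℝ (R τ) z := fun τ hτ z hz =>
    (hRω τ z hτ ((habs z).1 hz)).differentiableAt (by simp)
  have hR'd : ∀ τ : ℝ, |τ| < δ' → ∀ z ∈ Ioo (-δ') δ', DifferentiableAt ℝ (deriv (R τ)) z := fun τ hτ z hz =>
    (((hR1on τ hτ).differentiableOn (by norm_num)) z hz).differentiableAt (isOpen_Ioo.mem_nhds hz)
  /- STEP 9: the Huygens identity at every nearby time (LEAD g16's `huygens_identity`, pin-free). -/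
  have hHuy : ∀ q : ℝ × ℝ × ℝ, |q.1| < δ' → |q.2.2| < δ' →
      κt q.1 q.2.2 * (fderiv ℝ n₀ q ((0 : ℝ), (0 : ℝ), (1 : ℝ))) ^ 2 =
        (deriv (deriv (R q.1)) q.2.2 - μ (-1 + q.1) q.2.2 * κt q.1 q.2.2) * (1 + (fderiv ℝ n₀ q ((0 : ℝ), (1 : ℝ), (0 : ℝ))) ^ 2) := by
    intro q h1 h2
    obtain ⟨h1₀, -, hτh, -⟩ := hI q h1 h2
    set Gτ : ℝ × ℝ → ℝ := fun p => n₀ (q.1, p) with hGτ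
    have hmemI : ∀ p ∈ region (Ioo (-δ') δ'), |((q.1, p) : ℝ × ℝ × ℝ).2.2| < δ' := fun p hp => (habs p.2).1 hp
    have hGd' : ∀ p ∈ region (Ioo (-δ') δ'), DifferentiableAt ℝ Gτ p := fun p hp =>
      (hGτd (q.1, p) h1 (hmemI p hp)).differentiableAt
    have hWeq : ∀ p : ℝ × ℝ, webMap e Gτ p = frameCLM e (p.1, n₀ (q.1, p), p.2) := fun p => by
      simp only [webMap, hGτ, frameCLM_apply]
    have hH := huygens_identity (hF3τ q.1 hτh) e isOpen_Ioo hGd'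
      (R := R q.1) (κ := κt q.1) (μ := μ (-1 + q.1))
      (fun z hz => (hR'd q.1 h1 z hz).hasDerivAt) (fun z hz => hRd q.1 h1 z hz)
      (fun p hp => by rw [hWeq]; exact hcritν (q.1, p) h1₀ (hI (q.1, p) h1 (hmemI p hp)).2.1)
      (fun p hp => by
        have hh := hhoriz (q.1, p) h1₀ (hI (q.1, p) h1 (hmemI p hp)).2.1 e he2
        simp only at hh
        rw [hWeq, hFτ_def, fderiv_const_mul (((hθ2τ q.1 hτh).differentiable (by norm_num)) _)]
        simp [hh])
      (fun p hp => by rw [hWeq]; exact (hspec (q.1, p) h1₀ (hI (q.1, p) h1 (hmemI p hp)).2.1).2.1)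
      (fun p hp => by rw [hWeq]; exact hridge (q.1, p) h1 (hmemI p hp))
      (fun p hp => by rw [hWeq]; exact hslice (q.1, p) h1 (hmemI p hp) _)
      (p := q.2) ((habs q.2.2).2 h2)
    have hGz : fderiv ℝ Gτ q.2 (0, 1) = fderiv ℝ n₀ q ((0 : ℝ), (0 : ℝ), (1 : ℝ)) := by
      rw [(hGτd q h1 h2).fderiv]; simp
    have hGs : fderiv ℝ Gτ q.2 (1, 0) = fderiv ℝ n₀ q ((0 : ℝ), (1 : ℝ), (0 : ℝ)) := by
      rw [(hGτd q h1 h2).fderiv]; simp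
    rw [hGz, hGs] at hH
    exact hH
  /- STEP 10: parallel webs at `τ = 0` (`…ParallelWebs.parallelWebs`). -/
  have hpar : ∀ s z : ℝ, |z| < δ' → n₀ ((0 : ℝ), s, z) = n₀ ((0 : ℝ), (0 : ℝ), z) := by
    have h0' : |(0 : ℝ)| < δ' := by simpa using hδ'
    set G₀ : ℝ × ℝ → ℝ := fun p => n₀ ((0 : ℝ), p) with hG₀
    have hmemI : ∀ p ∈ region (Ioo (-δ') δ'), |(((0 : ℝ), p) : ℝ × ℝ × ℝ).2.2| < δ' := fun p hp => (habs p.2).1 hp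
    have hG2 : ContDiffOn ℝ 2 G₀ (region (Ioo (-δ') δ')) := by
      intro p hp
      have hq := hI ((0 : ℝ), p) h0' (hmemI p hp)
      exact ((hCm 2 ((0 : ℝ), p) hq.1 hq.2.1).comp p (contDiffAt_const.prodMk contDiffAt_id)).contDiffWithinAt
    have hWeq : ∀ p : ℝ × ℝ, webMap e G₀ p = frameCLM e (p.1, n₀ ((0 : ℝ), p), p.2) := fun p => by
      simp only [webMap, hG₀, frameCLM_apply]
    have hκ0d : ∀ z ∈ Ioo (-δ') δ', DifferentiableAt ℝ (κt 0) z := by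
      intro z hz
      have hq := hI ((0 : ℝ), (0 : ℝ), z) h0' ((habs z).1 hz)
      have hg : DifferentiableAt ℝ (fun z' : ℝ => frameCLM e (0, n₀ ((0 : ℝ), 0, z'), z')) z := by
        have h1 : DifferentiableAt ℝ (fun z' : ℝ => n₀ ((0 : ℝ), 0, z')) z :=
          ((hCm 1 ((0 : ℝ), (0 : ℝ), z) hq.1 hq.2.1).differentiableAt (by simp)).comp z
            ((differentiableAt_const _).prodMk ((differentiableAt_const _).prodMk differentiableAt_id))
        exact (frameCLM e).differentiable.differentiableAt.comp z ((differentiableAt_const _).prodMk (h1.prodMk differentiableAt_id))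
      have h := ((differentiableAt_sliceHessian_comp hFst (hTabs 0 (by norm_num)) hg e e).add
        (differentiableAt_sliceHessian_comp hFst (hTabs 0 (by norm_num)) hg (Jvec e) (Jvec e))).neg
      rw [hκt_def]; exact h
    have hR1on0 := hR1on 0 h0'
    have hR2on : ContDiffOn ℝ 1 (deriv (deriv (R 0))) (Ioo (-δ') δ') :=
      ((contDiffOn_succ_iff_deriv_of_isOpen isOpen_Ioo).1 (hR1on0.of_le (m := 1 + 1) (by norm_num))).2.2
    have hR''d : ∀ z ∈ Ioo (-δ') δ', DifferentiableAt ℝ (deriv (deriv (R 0))) z := fun z hz =>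
      ((hR2on.differentiableOn (by norm_num)) z hz).differentiableAt (isOpen_Ioo.mem_nhds hz)
    have hμfun : μ (-1) = uncurry μ ∘ fun z : ℝ => ((-1 : ℝ), z) := by funext z; rfl
    have hμd : ∀ z : ℝ, DifferentiableAt ℝ (μ (-1)) z := fun z => by
      rw [hμfun]; exact ((hμ3.differentiable (by norm_num)) _).comp z ((differentiableAt_const _).prodMk differentiableAt_id)
    have hcd : ∀ z ∈ Ioo (-δ') δ', DifferentiableAt ℝ (fun z => deriv (deriv (R 0)) z - μ (-1 + 0) z * κt 0 z) z := fun z hz => by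
      simp only [add_zero]; exact (hR''d z hz).sub ((hμd z).mul (hκ0d z hz))
    have hG00 : ∀ s : ℝ, G₀ (s, 0) = 0 := fun s => hn00 s
    have h := parallelWebs (hF3τ 0 (by norm_num)) e hδ' hG2
      (R := R 0) (κ := κt 0) (μ := μ (-1 + 0))
      (fun z hz => (hR'd 0 h0' z hz).hasDerivAt) (fun z hz => hRd 0 h0' z hz)
      (fun z hz => (hI ((0 : ℝ), (0 : ℝ), z) h0' ((habs z).1 hz)).2.2.2.2.2.1) hκ0d hcd
      (fun p hp => by rw [hWeq]; exact hcritν ((0 : ℝ), p) (by simpa using hδ₀) (hI ((0 : ℝ), p) h0' (hmemI p hp)).2.1)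
      (fun p hp => by
        have hh := hhoriz ((0 : ℝ), p) (by simpa using hδ₀) (hI ((0 : ℝ), p) h0' (hmemI p hp)).2.1 e he2
        simp only [add_zero] at hh
        rw [hWeq, hFτ_def, fderiv_const_mul (((hθ2τ 0 (by norm_num)).differentiable (by norm_num)) _)]
        simp [hh])
      (fun p hp => by rw [hWeq]; exact (hspec ((0 : ℝ), p) (by simpa using hδ₀) (hI ((0 : ℝ), p) h0' (hmemI p hp)).2.1).2.1)
      (fun p hp => by rw [hWeq]; exact hridge ((0 : ℝ), p) h0' (hmemI p hp))
      (fun p hp => by rw [hWeq]; exact hslice ((0 : ℝ), p) h0' (hmemI p hp) _)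
      hG00
    intro s z hz
    exact h s z ((habs z).2 hz)
  refine ⟨δ', n₀, κt, hδ', hδ'δ₀.trans hδ₀δ, hδ'δ₀.trans hδ₀ρ, lt_of_le_of_lt hδ'δ₀ hδ₀h, he2, hunit, fun q h1 h2 => ?_, hpar⟩
  obtain ⟨h1₀, h2₀, -, -, -, hκpos, -⟩ := hI q h1 h2
  obtain ⟨hin, hval, huniq⟩ := hspec q h1₀ h2₀
  refine ⟨hin, ?_, fun n hn hne => ?_, hhoriz q h1₀ h2₀, fun m => hCm m q h1₀ h2₀, hκpos, ?_, hHuy q h1 h2⟩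
  · rw [hFτ_def] at hval; exact hval
  · have h := huniq n hn hne; rw [hFτ_def] at h; exact h
  · have h := hridge q h1 h2; rw [hFτ_def] at h; exact h

end Summit.NavierStokesRegularity.NavierStokesRegularity.Theorems.PoloidalWindowDoorLrcModEntireQ4TimeWebPackage

end
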